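import Summits.AtomisticToContinuum.HydrodynamicLimit.Theorems.AntiMazurCoboundariesKineticWindowGronwallWindowClauseOfRenyi
import Summits.AtomisticToContinuum.HydrodynamicLimit.Theorems.AntiMazurCoboundariesKineticWindowGronwallDensityOnlyWindowRenyi
import HarnessLib

/-!
# The window clause costs nothing for DENSITY-ONLY local Gibbs data
# (stub `stub_densityOnlyWindowClause`, line `board-node-dock`, crux `KineticWindowGronwall`, stmt-AtomisticToContinuum-9282)

Crux `Summit.AtomisticToContinuum.HydrodynamicLimit.Theses.AntiMazurCoboundaries.KineticWindowGronwall`. Composition of the two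
landed toolkit pieces toward content (iii) of the local kinetic node `KineticWindowGronwallPlusNode.KineticWindowLDBoundsUniform`:
`KineticWindowGronwallWindowClauseOfRenyi.stub_windowClauseOfRenyi` (Rényi quasi-invariance over kinetic windows + the window
exponential-moment bound on ONE band of windows `τ ∈ [τ₀, 2τ₀]` at tilt radius `b` ⟹ ALL windows `τ ≥ τ₀` at radius `b/q`) fed with
`KineticWindowGronwallDensityOnlyWindowRenyi.stub_densityOnlyWindowRenyi` (for constant temperature and drift and a continuous
activity `a > 0` the order-`p` Rényi integral is `≤ e^{ε(N+1)}` for EVERY `p ≥ 1`, by conservation of energy and momentum).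
Consequence: for density-only data the window clause `∃ τ₀ ∀ τ ≥ τ₀` of the node is equivalent to a bound on one band of windows,
at an arbitrarily small loss `b ↦ b/q`, `q > 1`, in the tilt radius (take `p = q/(q−1)`). For general data the same upgrade holds
conditionally on the Rényi hypothesis of `WindowClauseOfRenyi` (the open dynamic input: collisional energy/momentum traffic between
partners at different temperature/drift). Folklore; no Theses declaration is concluded, no named fact is used.
-/

noncomputable section

namespace Summit.AtomisticToContinuum.HydrodynamicLimit.Theorems.KineticWindowGronwallDensityOnlyWindowClause

open _root_.MeasureTheory _root_.Set _root_.Filter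
open scoped _root_.ENNReal
open Literature.Analysis.FluidPDE Literature.MathematicalPhysics.KineticTheory
open Summit.AtomisticToContinuum.HydrodynamicLimit.Theorems.KineticWindowGronwallWindowClauseOfRenyi (TFlow windowMoment)

/-- **Helper statement `DensityOnlyWindowClause`**: for DENSITY-ONLY continuous local Gibbs data (constant `θc > 0`, constant
`uc`, activity `a > 0`), every flow family and every continuous one-body functional `F`, the window exponential-moment bound on
ONE band of windows `τ ∈ [τ₀, 2τ₀]` at tilt radius `b` implies the bound on ALL windows `τ ≥ τ₀` at tilt radius `b/q`, for every
`q > 1` (`windowMoment` is the node's functional, `KineticWindowGronwallWindowClauseOfRenyi.windowMoment`). -/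
def DensityOnlyWindowClause : Prop :=
  ∀ (θc : ℝ), 0 < θc → ∀ (uc : V3) (a : T3 → ℝ), Continuous a → (∀ x, 0 < a x) →
    ∀ (σ : ℝ) (Φ : (N : ℕ) → TFlow σ N) (F : T3 × V3 → ℝ), Continuous F →
    ∀ (b τ₀ : ℝ), 0 < τ₀ →
    (∀ β : ℝ, |β| ≤ b → ∀ ε : ℝ, 0 < ε → ∀ τ ∈ Icc τ₀ (2 * τ₀), ∃ N₀ : ℕ, ∀ N : ℕ, N₀ ≤ N →
        windowMoment σ a (fun _ => θc) (fun _ => uc) Φ F N τ β ≤ ENNReal.ofReal (Real.exp (ε * ((N : ℝ) + 1)))) →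
    ∀ q : ℝ, 1 < q → ∀ β : ℝ, |β| ≤ b / q → ∀ ε : ℝ, 0 < ε → ∀ τ : ℝ, τ₀ ≤ τ → ∃ N₀ : ℕ, ∀ N : ℕ, N₀ ≤ N →
        windowMoment σ a (fun _ => θc) (fun _ => uc) Φ F N τ β ≤ ENNReal.ofReal (Real.exp (ε * ((N : ℝ) + 1)))

/-- **`stub_densityOnlyWindowClause`**: `DensityOnlyWindowClause` holds — `stub_windowClauseOfRenyi` fed with the density-only
Rényi quasi-invariance `stub_densityOnlyWindowRenyi` at the conjugate order `p = q/(q−1)`. [folklore] -/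
theorem stub_densityOnlyWindowClause : DensityOnlyWindowClause := by
  intro θc hθc uc a ha ha0 σ Φ F hF b τ₀ hτ₀ hW q hq β hβ ε hε τ hτ
  have hpq : (q / (q - 1)).HolderConjugate q := by
    rw [Real.holderConjugate_iff]
    refine ⟨?_, ?_⟩
    · rw [lt_div_iff₀ (by linarith)]; linarith
    · field_simp; ring
  have hR := KineticWindowGronwallDensityOnlyWindowRenyi.stub_densityOnlyWindowRenyi θc hθc uc a ha ha0 σ (q / (q - 1))
    hpq.lt.le
  refine KineticWindowGronwallWindowClauseOfRenyi.stub_windowClauseOfRenyi σ a (fun _ => θc) (fun _ => uc) ha continuous_const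
    continuous_const ha0 (fun _ => hθc) Φ F hF (q / (q - 1)) q hpq ?_ b τ₀ hτ₀ hW β hβ ε hε τ hτ
  intro τ' ε' hτ' hε'
  obtain ⟨N₀, hN₀⟩ := hR τ' ε' hτ' hε'
  refine ⟨N₀, fun N hN s hs0 hs => ?_⟩
  have h := hN₀ N hN (Φ N) s (by rwa [abs_of_nonneg hs0])
  simpa only [KineticWindowGronwallDensityOnlyWindowRenyi.lgDensity, KineticWindowGronwallWindowClauseOfRenyi.lgDensity] using h

end Summit.AtomisticToContinuum.HydrodynamicLimit.Theorems.KineticWindowGronwallDensityOnlyWindowClause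

end
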